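import Mathlib
import Summits.Langlands.Langlands.Theses.NonParallelVoid
import Literature.NumberTheory.GaloisRepresentations.PstCrystallineExtensionData
import Literature.NumberTheory.GaloisRepresentations.EnormousSubgroup
import Literature.NumberTheory.GaloisRepresentations.ProjectiveType
import Literature.NumberTheory.GaloisRepresentations.DecomposedGeneric
import Literature.NumberTheory.GaloisRepresentations.AbsGaloisGroup
import Literature.NumberTheory.Automorphic.Qian2022PotentialAutomorphy
import Literature.NumberTheory.GaloisRepresentations.ResidualRepRestrict
import Literature.NumberTheory.GaloisRepresentations.ResidualGaloisRepOpenKernel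
import Literature.NumberTheory.GaloisRepresentations.ResiduallyReducibleOfStableLine
import Literature.RingTheory.Valuation.AlgClosedResidue
import Summits.Langlands.Langlands.Theorems.RamifiedCoefficientSeedAdjointLiftingGL3StubAdjointResidualImageHelpers
import Summits.Langlands.Langlands.Theorems.NonParallelVoidTensorSquareParallelStubEnormousResidualPackageDecomposedGeneric
import Summits.Langlands.Langlands.Theorems.NonParallelVoidTensorSquareParallelStubEnormousResidualPackageEnormousOfDihedral
import Summits.Langlands.Langlands.Theorems.NonParallelVoidTensorSquareParallelStubEnormousResidualPackageScalarElement
import HarnessLib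

/-!
# Stub `stub_enormousResidualPackage` of line `merged` for crux `TensorSquareParallel`
# (stmt-Langlands-17009): the residual image package (Qian 2023, Thm. 1.4 (iii)–(iv)) in the
# projectively dihedral, prime-to-`p` corner — PROVED

Crux `stmt-Langlands-17009` = `Summit.Langlands.Langlands.Theses.NonParallelVoid.TensorSquareParallel`
(`F` imaginary quadratic, `p ≥ 11` split in `F`, `ρ : Γ_F → GL₂(ℚ̄_p)` crystalline with odd
labelled-gap sum, `ρ̄|_{Γ_{F(ζ_p)}}` absolutely irreducible, `ρ̄` not of base-change type ⟹ `False`),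
line `merged`, stub `stub_enormousResidualPackage` (registered signature, landing namespace
`Summit.Langlands.Langlands.Theorems.TensorSquareParallel`).  Given the output of the neighbouring
stub `stub_dihedralType_of_trace` — `r := ρ̄ ∘ (Γ_{F(ζ_p)} ↪ Γ_F)` (`ρ̄ = ρ.residualRep`, the tree's
chosen semisimplified reduction, `Γ_{F(ζ_p)} = absGaloisGroupAdjoinRootsOfUnity F p`) is of
dihedral type with finite image of order prime to `p` — this file assembles the six conjuncts
consumed by `Qian2022.potentialAutomorphy_ordinary` (hypotheses (iii)–(iv) of Qian 2023,
Thm. 1.4):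

1. `ρ̄` is a residual representation of `ρ` — rank two, tree
   `FramedGaloisRep.isResidualRepOf_residualRep_fin_two`;
2. & 4. `ρ̄` and `r` are absolutely irreducible — the lattice bridge
   `isAbsIrreducible_of_isResidualRepOf_of_restrictField_numberField` below (Brauer–Nesbitt: `ρ̄ ∘ res`
   and the absolutely irreducible reduction of `ρ|_{Γ_{F(ζ_p)}}` have the same characteristic
   polynomials; the sibling crux's `isAbsIrreducible_of_charpoly_eq`, `IsAbsIrreducible.of_range_le`);
3. `ρ̄` is decomposed generic — Caraiani–Newton 2023, Lemma 6.2.2 for `GL₂(𝔽̄_p)` (helper file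
   `…StubEnormousResidualPackageDecomposedGeneric`: the projective image of `r` is `≅ D_m`, `m ≥ 2`,
   non-trivial of order prime to `p`; the kernel of `ρ̄` is open);
5. `ρ̄(Γ_{F(ζ_p)}) = r(Γ_{F(ζ_p)})` is enormous (ACC+ Def. 6.2.28) — helper file
   `…StubEnormousResidualPackageEnormousOfDihedral` (`𝔽̄_p = ℤ̄_p/𝔪` is algebraically closed,
   `Literature.RingTheory.Valuation.isAlgClosed_residueField`, of characteristic `p`, with units of
   finite prime-to-`p` order, `exists_pow_eq_one_padicAlgClResidueField`);
6. a scalar `ρ̄(σ)` with `σ ∉ Γ_{F(ζ_p)}` — helper file `…StubEnormousResidualPackageScalarElement`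
   (`[F : ℚ] = 2`, `p ≥ 11`).

The hypotheses "`F` totally complex" and "`p` split in `F`" of the registered signature are not
used.

## References

* [Qian2022] L. Qian, *Potential automorphy for `GL_n`*, Invent. Math. 231 (2023), Thm. 1.4.
* [ACCGHLNSTT2023] P. B. Allen et al., *Potential automorphy over CM fields*, Ann. of Math. 197
  (2023), Def. 4.3.1, Def. 6.2.28.
* [CaraianiNewton2023] A. Caraiani, J. Newton, arXiv:2301.10509v3, Lemma 6.2.2.
* [DarmonDiamondTaylor1995] H. Darmon, F. Diamond, R. Taylor, *Fermat's Last Theorem* (1995), §2.1.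
-/

noncomputable section

set_option linter.dupNamespace false  -- `Summit.Langlands.Langlands.…` is the mandated summit-side namespace (D-0022)

open scoped NumberField MatrixGroups
open IsDedekindDomain Field
open Literature.NumberTheory.GaloisRepresentations Literature.NumberTheory.PAdicHodge
  Literature.NumberTheory.Automorphic
open Summit.Langlands.Langlands.Cruxes.AdjointLiftingGL3.Birth

namespace Summit.Langlands.Langlands.Theorems.TensorSquareParallel

/-! ## §3. The lattice bridge over a number field -/
section Bridge

variable {F : Type} [Field F] [NumberField F] {p : ℕ} [Fact p.Prime] {n : ℕ}

/-- **The bridge over a number field `F`**: if `ρ|_{Γ_L}`, `L = F(ζ_p)` (`CyclotomicField p F`), is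
residually absolutely irreducible and `τ : Γ_F → GL_n(ℤ̄_p/𝔪)` has the residual characteristic
polynomials of `ρ`, then `τ` is absolutely irreducible on `Γ_{F(ζ_p)} = res(Γ_L)` and on `Γ_F`
(`isAbsIrreducible_of_charpoly_eq`; the sibling file's `ℚ`-version with `ℚ ↦ F`).
[cite: DarmonDiamondTaylor1995, §2.1 (Prop. 2.6 (b))] -/
theorem isAbsIrreducible_of_hasResidualCharpolys_of_restrictField_numberField
    (ρ : FramedGaloisRep F (PadicAlgCl p) n)
    (hirr : (ρ.restrictField (CyclotomicField p F)).IsResiduallyAbsIrreducible)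
    {τ : absoluteGaloisGroup F →* GL (Fin n) (padicAlgClResidueField p)}
    (hτ : HasResidualCharpolys (RingHom.id _)
      (ρ : absoluteGaloisGroup F →* GL (Fin n) (PadicAlgCl p)) τ) :
    IsAbsIrreducible (τ.comp (absGaloisGroupAdjoinRootsOfUnity F p).subtype) ∧
      IsAbsIrreducible τ := by
  have hp : p.Prime := Fact.out
  haveI : NeZero ((p : ℕ) : F) := NeZero.charZero
  haveI : IsCyclotomicExtension {p} F (CyclotomicField p F) :=
    CyclotomicField.isCyclotomicExtension p F
  set res := (absGaloisRestrict F (CyclotomicField p F)).toMonoidHom with hres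
  obtain ⟨τL, hτL, habsL⟩ := hirr
  -- `τ ∘ res` has the residual characteristic polynomials of `ρ|_{Γ_L} = ρ ∘ res`
  have h1 : HasResidualCharpolys (RingHom.id _)
      ((ρ.restrictField (CyclotomicField p F) : FramedGaloisRep (CyclotomicField p F) (PadicAlgCl p) n) :
        absoluteGaloisGroup (CyclotomicField p F) →* GL (Fin n) (PadicAlgCl p)) (τ.comp res) :=
    hτ.comp res
  have hcp : ∀ h, ((τ.comp res h : GL (Fin n) (padicAlgClResidueField p)) :
      Matrix (Fin n) (Fin n) (padicAlgClResidueField p)).charpoly =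
      ((τL h : GL (Fin n) (padicAlgClResidueField p)) :
        Matrix (Fin n) (Fin n) (padicAlgClResidueField p)).charpoly :=
    fun h => h1.charpoly_eq hτL.hasResidualCharpolys h
  have habs : IsAbsIrreducible (τ.comp res) := isAbsIrreducible_of_charpoly_eq hcp habsL
  have hrange : (τ.comp res).range = (τ.comp (absGaloisGroupAdjoinRootsOfUnity F p).subtype).range := by
    rw [MonoidHom.range_comp, MonoidHom.range_comp, Subgroup.range_subtype]
    congr 1
    exact range_absGaloisRestrict_eq_absGaloisGroupAdjoinRootsOfUnity F (CyclotomicField p F) p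
  refine ⟨IsAbsIrreducible.of_range_le habs hrange.le, IsAbsIrreducible.of_range_le habs ?_⟩
  rw [MonoidHom.range_comp]
  exact Subgroup.map_le_range _ _

/-- **Every residual representation of `ρ : Γ_F → GL_n(ℚ̄_p)` is absolutely irreducible on
`Γ_{F(ζ_p)}` and on `Γ_F`** when `ρ|_{Γ_{F(ζ_p)}}` is residually absolutely irreducible (a residual
representation has the residual characteristic polynomials of `ρ`).
[cite: DarmonDiamondTaylor1995, §2.1 (Prop. 2.6 (b))] -/
theorem isAbsIrreducible_of_isResidualRepOf_of_restrictField_numberField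
    (ρ : FramedGaloisRep F (PadicAlgCl p) n)
    (hirr : (ρ.restrictField (CyclotomicField p F)).IsResiduallyAbsIrreducible)
    {τ : absoluteGaloisGroup F →* GL (Fin n) (padicAlgClResidueField p)}
    (hτ : ρ.IsResidualRepOf (RingHom.id _) τ) :
    IsAbsIrreducible (τ.comp (absGaloisGroupAdjoinRootsOfUnity F p).subtype) ∧
      IsAbsIrreducible τ :=
  isAbsIrreducible_of_hasResidualCharpolys_of_restrictField_numberField ρ hirr
    hτ.hasResidualCharpolys

end Bridge

/-! ## The package -/

/-- **Stub `stub_enormousResidualPackage` (registered signature verbatim) — the residual image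
package of Qian 2023, Thm. 1.4 (iii)–(iv) for `ρ̄ = ρ.residualRep`, `ρ : Γ_F → GL₂(ℚ̄_p)`, `F`
imaginary quadratic, `p ≥ 11`, when `r = ρ̄|_{Γ_{F(ζ_p)}}` is of dihedral type with finite image of
order prime to `p` and `ρ|_{Γ_{F(ζ_p)}}` is residually absolutely irreducible**: (i) `ρ̄` is a
residual representation of `ρ`; (ii) `ρ̄` absolutely irreducible; (iii) decomposed generic
(Caraiani–Newton 6.2.2); (iv) `r` absolutely irreducible; (v) `ρ̄(Γ_{F(ζ_p)})` enormous (ACC+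
Def. 6.2.28); (vi) some `σ ∉ Γ_{F(ζ_p)}` with `ρ̄(σ)` scalar.  Assembly of the three helper files and
the bridge above (module docstring). [cite: Qian2022, Thm. 1.4 (hypotheses (iii)–(iv))] -/
theorem stub_enormousResidualPackage :
    ∀ (F : Type) [Field F] [NumberField F] [Algebra.IsQuadraticExtension ℚ F], NumberField.IsTotallyComplex F → ∀ (p : ℕ) [Fact p.Prime] (ρ : FramedGaloisRep F (PadicAlgCl p) 2), 11 ≤ p → (∃ v w : HeightOneSpectrum (𝓞 F), v ≠ w ∧ ((p : ℕ) : 𝓞 F) ∈ v.asIdeal ∧ ((p : ℕ) : 𝓞 F) ∈ w.asIdeal) → FramedGaloisRep.IsResiduallyAbsIrreducible (ρ.restrictField (CyclotomicField p F)) → IsDihedralType (ρ.residualRep.comp (absGaloisGroupAdjoinRootsOfUnity F p).subtype) → Finite (ρ.residualRep.comp (absGaloisGroupAdjoinRootsOfUnity F p).subtype).range → ¬ p ∣ Nat.card (ρ.residualRep.comp (absGaloisGroupAdjoinRootsOfUnity F p).subtype).range → (ρ.IsResidualRepOf (RingHom.id _) ρ.residualRep ∧ IsAbsIrreducible ρ.residualRep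 ∧ IsDecomposedGeneric ρ.residualRep ∧ IsAbsIrreducible (ρ.residualRep.comp (absGaloisGroupAdjoinRootsOfUnity F p).subtype) ∧ Subgroup.IsEnormous ((absGaloisGroupAdjoinRootsOfUnity F p).map ρ.residualRep) ∧ ∃ σ : absoluteGaloisGroup F, σ ∉ absGaloisGroupAdjoinRootsOfUnity F p ∧ ∃ c : padicAlgClResidueField p, ((ρ.residualRep σ : GL (Fin 2) (padicAlgClResidueField p)) : Matrix (Fin 2) (Fin 2) (padicAlgClResidueField p)) = c • (1 : Matrix (Fin 2) (Fin 2) (padicAlgClResidueField p))) := by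
  intro F _ _ _ _ p _ ρ hp _ hirr hdih hfin hcop
  haveI := hfin
  have hp2 : p ≠ 2 := by omega
  have hF2 : Module.finrank ℚ F = 2 := Algebra.IsQuadraticExtension.finrank_eq_two ℚ F
  haveI : CharP (padicAlgClResidueField p) p := charP_padicAlgClResidueField p
  haveI : IsAlgClosed (padicAlgClResidueField p) :=
    Literature.RingTheory.Valuation.isAlgClosed_residueField (padicAlgClIntegers p)
  set Γ₁ := absGaloisGroupAdjoinRootsOfUnity F p with hΓ₁
  set τ := ρ.residualRep with hτdef
  set r := τ.comp Γ₁.subtype with hr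
  -- (i) `ρ̄` is a residual representation of `ρ` (rank two)
  have hres : ρ.IsResidualRepOf (RingHom.id _) τ := ρ.isResidualRepOf_residualRep_fin_two
  -- (ii), (iv) absolute irreducibility of `ρ̄` and of `r`
  obtain ⟨habs₁, habs⟩ :=
    isAbsIrreducible_of_isResidualRepOf_of_restrictField_numberField ρ hirr hres
  -- (v) enormous image on `Γ_{F(ζ_p)}`
  have hrange : Γ₁.map τ = r.range := by
    rw [hr, MonoidHom.range_comp, Subgroup.range_subtype]
  have hen : Subgroup.IsEnormous (Γ₁.map τ) := by
    rw [hrange]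
    exact isEnormous_range_of_isDihedralType hp2 (exists_pow_eq_one_padicAlgClResidueField p) r
      hcop habs₁ hdih
  -- (iii) decomposed generic (Caraiani–Newton 6.2.2): `Proj r(Γ₁) ≅ D_m` is non-trivial, finite,
  -- of order prime to `p`, and `ker ρ̄` is open
  haveI : Finite (projectiveImage r) := finite_projectiveImage_of_finite_range r
  have hPcop : ¬ p ∣ Nat.card (projectiveImage r) := fun h ↦
    hcop (h.trans (Subgroup.card_dvd_of_surjective _ (rangeToProjectiveImage_surjective r)))
  have hPne : projectiveImage r ≠ ⊥ := by
    obtain ⟨m, hm, ⟨e⟩⟩ := hdih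
    intro hbot
    have h1 : Nat.card (projectiveImage r) = 2 * m :=
      (Nat.card_congr e.toEquiv).trans DihedralGroup.nat_card
    rw [hbot, Subgroup.card_bot] at h1
    omega
  have hdg : IsDecomposedGeneric τ :=
    isDecomposedGeneric_of_projectiveImage_ne_bot F hF2 hp2 τ
      (FramedGaloisRep.isOpen_ker_of_isResidualRepOf hres) hPne hPcop
  -- (vi) the scalar element
  exact ⟨hres, habs, hdg, habs₁, hen, exists_not_mem_scalar_of_isDihedralType p F hF2 hp τ hcop hdih⟩

end Summit.Langlands.Langlands.Theorems.TensorSquareParallel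

end
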